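import Summits.QuantumFields.BalabanUV.Beta.EriceRemainderEnclosureHistoryAutonomyComparisonAgeComposition

/-!
# EriceRemainderEnclosureHistoryAutonomyComparisonAgeCompositionBVStability — (E115a) route (N), first order, ABSTRACT: POSITIVITY IS BV-STABILITY, AND
# YOUNG SYSTEMS ARE LOCAL.  For a triangular renewal system `t = w − R t` (reads `R v n = Σ_{l<N} K n l·v (n+1+l)`, `K ≥ 0`, zero tail beyond `N`):
# (i) every zero-tailed input is the signed combination `w = Σ_{J≤N} (w J − w (J+1))·1_{[0,J]}` of the truncated indicators and the solution is the SAME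
# combination of the indicator solutions (**`sol_eq_sum_indicator`**); hence (ii) THE END AT EVERY TRUNCATION (`0 ≤ S 1_{[0,J]} ≤ 1` for all `J`) IS
# EQUIVALENT TO A TOTAL-VARIATION BOUND ON ARBITRARY INPUTS: `|S w n| ≤ Σ_{n≤J≤N} |w J − w (J+1)|` (**`abs_sol_le_var`**), with the one-sided forms
# `S w n ≤ PosVar_n w` (**`sol_le_posVar`**) and `S w n ≥ u·PosVar_n w + NegVar_n w` under a floor `u ≤ S 1_{[0,J]} n` (**`sol_ge_var`**), i.e. for a
# non-negative input **`S w n ≥ u·w n − (1−u)·Inc_n w`** (`Inc_n w` = the total INCREASE of `w` below `n`; **`sol_ge_floor_sub_increase`**) — positivity on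
# monotone excesses is STABILITY under almost-monotone ones, every unit of upward variation costing at most `1 − u`; (iii) a kernel with row sums `≤ ρ ≤ 1`
# reading only the lags `< k` (a YOUNG system) is LOCAL: an input vanishing on `D` consecutive young windows is felt `D` windows above only through a factor
# `ρ^D` (**`abs_sol_le_pow_of_gap`**; no amplification across a gap, **`abs_sol_le_of_gap`**); (iv) light rows have the floor `S e ≥ (1 − ρ_n)·e`
# (**`sol_ge_one_sub_row`**); (v) together, **`sol_ge_local`**: for a young system with floor `u` and a non-negative excess `f`,
#     `S f n ≥ u·f n − (1 − u)·Σ_{n≤J<n+Dk} max (f (J+1) − f J) 0 − ρ^D·(f (n+Dk) + Var_{≥ n+Dk} f)`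
# — THE ROBUST LOCAL END: the young surplus is the floor times the excess at the pin, minus the increase of the excess over the next `D` young windows,
# minus a far field damped geometrically.  This is the KEY-free form of the composition step of (E71a): there the old surplus `v = S_O e` had to be a
# young SUPERSOLUTION (KEY, a Harnack statement the census could not pay in every corner, READMEs g62–g80); here it only has to INCREASE LITTLE over a
# few young windows near the pin — the quantity that scale separation makes small (README `HOME/b2b-balaban-beta-d4-p2/g96/README.md` §2–§4: along
# admissible flows the old surplus varies on old scales, relatively to itself, so the increase over `D` young windows is `O(D·k_y∕k_o)` of it).

Cell `pub-balaban`, β-function sub-cell, BINDER row D4 «RemainderConst leaves for Bałaban's split» (`HOME/BINDER-OWNERS.md`; owner lineage `b2b-balaban-beta-an4`;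
this file by co-owner #2 lineage `b2b-balaban-beta-d4-p2`, generation 96), β-FLOW TEAM duty (1), FREEZE (0) honoured (def-free; imports (E71a) `…AgeComposition`
only and uses its `read_sum`, `sol_unique`, `sol_eq_zero_of_tail`, `read_le_read`, `sol_nonneg_le_of_antitone` BY NAME; nothing restated; pure renewal
algebra — no flow object enters).

HONEST FRAMING (page 1, verbatim and binding).  *"Discharging BetaPertH makes Bałaban's UV stability UNCONDITIONAL — a real constructive-QFT result; it is
NOT the continuum limit and NOT the Clay problem."*  THIS FILE DISCHARGES NOTHING OF THE KIND.  Elementary linear algebra about ABSTRACT real sequences and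
triangular systems — tools for the cell's own first-order census (route (N) of conjecture (E58′)); the form, signs, ages and moments of Bałaban's (1.22) limit
functional are NOT PRINTED ([I] p. 298; GAPS G-t4-U2-1∕-2) and NOT asserted.  Row D4 class UNCHANGED (critical-path width 0; instance 0∕1; D4 DISCHARGE NO
DATE).  HONEST DEPENDENCY: continuum YM on T⁴ ⇐ BetaPertH ∧ nine spine estimates (0/9 proved); BetaPertH ⇐ (D1) ∧ (D4) ∧ CAP+tail; G-an2-4 gates asym, D1
and NE2/3/4.

THE POINT (README g96 §4).  The every-range END of route (N) holds in the two extreme regimes by two mechanisms — light load when the ages are dense, EXACT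
MULTIPLICATIVITY over scales when they are sparse (README §2: in the limit of infinite ratios `ε_0 = Π_i u_i(0)`, each factor a lone-age END value) — and
every closed-form certificate of the census is finite-range because it is additive (README g95 §2).  A multiplicative induction over the ages needs, at the
step «add the youngest age `y` below the old system `O`», a lower bound for `S_y (S_O e)` in terms of `S_O e` AT THE PIN; (E71a)∕(E71c) asked for KEY
(`K_y v ≤ v`, `v = S_O e`), (E71d) turned it into the static chain, and the monotonicity side conditions failed in corners (README g77∕e86).  The theorem
here asks nothing of `v` but its values: `S_y v n ≥ u_y·v n − (1−u_y)·(increase of v over D young windows) − ρ^D·(far field)`, with `u_y = 1 − x̃_y ≥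
1 − √2∕2` for a lone age (§4 with (E89b)).  What remains for the flow (NOT done here): the RELATIVE smallness of the old surplus's increase over young
windows (README §3: `≲ C·t_o·k_y∕k_o` of itself near the pin) — a regularity statement about OLD systems, to be proved by the same induction.
NOT CLAIMED: any flow instance; KEY; MONO; the END beyond the tree's classes; anything printed — NOT B12 Thm 2, NOT BetaPertH, NOT continuum, NOT Clay.

WHAT IS PROVED ([folklore]; 0 `def`, 0 sorry; hypotheses display the reads `R` and the zero-tailed solution operator `S` as data, (E71a)'s conventions).
§1 `read_smul`, **`sum_steps_eq`** (Abel decomposition), **`sol_eq_sum_indicator`**, `indicator_sol_eq_zero`, `sol_eq_sum_Ico`.  §2 **`sol_le_posVar`**,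
**`sol_ge_var`**, **`abs_sol_le_var`**, `sum_Ico_steps`, **`sol_ge_floor_sub_increase`**.  §3 **`abs_sol_le_of_gap`**, **`abs_sol_le_pow_of_gap`**.
§4 **`sol_ge_one_sub_row`**.  §5 `read_add'`, `sol_add`, **`sol_ge_local`**.
-/
noncomputable section
open Finset

namespace Summit.QuantumFields.BalabanUV.Beta.EriceRemainderEnclosureHistoryAutonomyComparisonAgeCompositionBVStability

open Summit.QuantumFields.BalabanUV.Beta.EriceRemainderEnclosureHistoryAutonomyComparisonAgeComposition

variable {N : ℕ} {K : ℕ → ℕ → ℝ} {R S : (ℕ → ℝ) → ℕ → ℝ}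

/-! ## §1 Reads are linear; the step decomposition of a zero-tailed input -/

/-- Reads commute with scalars. [folklore] -/
theorem read_smul (hR : ∀ v n, R v n = ∑ l ∈ range N, K n l * v (n + 1 + l)) (c : ℝ) (v : ℕ → ℝ) (n : ℕ) :
    R (fun m => c * v m) n = c * R v n := by
  rw [hR, hR, mul_sum]
  exact sum_congr rfl fun l _ => by ring

/-- **ABEL DECOMPOSITION.**  A sequence vanishing beyond the horizon `N` is the signed combination of the truncated indicators
`1_{[0,J]}`, `J ≤ N`, with the steps `f J − f (J+1)` as coefficients. [folklore] -/
theorem sum_steps_eq {f : ℕ → ℝ} (hf : ∀ n, N < n → f n = 0) (n : ℕ) :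
    ∑ J ∈ range (N + 1), (f J - f (J + 1)) * (if n ≤ J then (1 : ℝ) else 0) = f n := by
  have key : ∀ M, ∑ J ∈ range M, (f J - f (J + 1)) * (if n ≤ J then (1 : ℝ) else 0) = if n < M then f n - f M else 0 := by
    intro M
    induction M with
    | zero => simp
    | succ M ih =>
      rw [sum_range_succ, ih]
      by_cases h1 : n < M
      · rw [if_pos h1, if_pos (h1.le), if_pos (by omega)]; ring
      · by_cases h2 : n = M
        · subst h2; rw [if_neg h1, if_pos le_rfl, if_pos (by omega)]; ring
        · rw [if_neg h1, if_neg (by omega), if_neg (by omega)]; ring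
  rw [key]
  by_cases hn : n < N + 1
  · rw [if_pos hn, hf (N + 1) (by omega), sub_zero]
  · rw [if_neg hn, hf n (by omega)]

/-- **THE SOLUTION IS THE SAME COMBINATION OF THE INDICATOR SOLUTIONS.**  `S w` = the zero-tailed solution of `v = w − R v` (for zero-tailed `w`);
then for every input `f` vanishing beyond `N`: `S f = Σ_{J ≤ N} (f J − f (J+1))·S 1_{[0,J]}`. [folklore] -/
theorem sol_eq_sum_indicator (hR : ∀ v n, R v n = ∑ l ∈ range N, K n l * v (n + 1 + l))
    (hS : ∀ w : ℕ → ℝ, (∀ n, N < n → w n = 0) → (∀ n, N < n → S w n = 0) ∧ ∀ n, S w n = w n - R (S w) n)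
    {f : ℕ → ℝ} (hf : ∀ n, N < n → f n = 0) :
    ∀ n, S f n = ∑ J ∈ range (N + 1), (f J - f (J + 1)) * S (fun m => if m ≤ J then (1 : ℝ) else 0) n := by
  have hind : ∀ J, J < N + 1 → ∀ n, N < n → (fun m => if m ≤ J then (1 : ℝ) else 0) n = 0 :=
    fun J hJ n hn => if_neg (show ¬ n ≤ J by omega)
  set u : ℕ → ℝ := fun n => ∑ J ∈ range (N + 1), (f J - f (J + 1)) * S (fun m => if m ≤ J then (1 : ℝ) else 0) n with hu
  have hut : ∀ n, N < n → u n = 0 := fun n hn =>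
    sum_eq_zero fun J hJ => by rw [(hS _ (hind J (mem_range.mp hJ))).1 n hn, mul_zero]
  have hurec : ∀ n, u n = f n - R u n := by
    intro n
    have hRu : R u n = ∑ J ∈ range (N + 1), (f J - f (J + 1)) * R (S (fun m => if m ≤ J then (1 : ℝ) else 0)) n := by
      rw [hu, read_sum hR]
      exact sum_congr rfl fun J _ => read_smul hR _ _ _
    rw [hRu, ← sum_steps_eq hf n, ← sum_sub_distrib]
    exact sum_congr rfl fun J hJ => by rw [(hS _ (hind J (mem_range.mp hJ))).2 n]; ring
  exact sol_unique hR (hS f hf).1 (hS f hf).2 hut hurec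

/-- The indicator solutions below the truncation vanish: `S 1_{[0,J]} n = 0` for `J < n`. [folklore] -/
theorem indicator_sol_eq_zero (hR : ∀ v n, R v n = ∑ l ∈ range N, K n l * v (n + 1 + l))
    (hS : ∀ w : ℕ → ℝ, (∀ n, N < n → w n = 0) → (∀ n, N < n → S w n = 0) ∧ ∀ n, S w n = w n - R (S w) n)
    {J : ℕ} (hJ : J ≤ N) {n : ℕ} (hJn : J < n) : S (fun m => if m ≤ J then (1 : ℝ) else 0) n = 0 := by
  have hind : ∀ m, N < m → (fun m => if m ≤ J then (1 : ℝ) else 0) m = 0 := fun m hm => if_neg (show ¬ m ≤ J by omega)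
  exact sol_eq_zero_of_tail (c := N - J) hR (hS _ hind).1 (hS _ hind).2 (fun m hm => if_neg (show ¬ m ≤ J by omega)) n (by omega)

/-- The combination restricted to the truncations `J ≥ n`: `S f n = Σ_{n ≤ J ≤ N} (f J − f (J+1))·S 1_{[0,J]} n`. [folklore] -/
theorem sol_eq_sum_Ico (hR : ∀ v n, R v n = ∑ l ∈ range N, K n l * v (n + 1 + l))
    (hS : ∀ w : ℕ → ℝ, (∀ n, N < n → w n = 0) → (∀ n, N < n → S w n = 0) ∧ ∀ n, S w n = w n - R (S w) n)
    {f : ℕ → ℝ} (hf : ∀ n, N < n → f n = 0) {n : ℕ} (hn : n ≤ N + 1) :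
    S f n = ∑ J ∈ Ico n (N + 1), (f J - f (J + 1)) * S (fun m => if m ≤ J then (1 : ℝ) else 0) n := by
  rw [sol_eq_sum_indicator hR hS hf n, ← sum_range_add_sum_Ico _ hn, add_eq_right]
  exact sum_eq_zero fun J hJ => by rw [indicator_sol_eq_zero hR hS (by have := mem_range.mp hJ; omega) (mem_range.mp hJ), mul_zero]

/-! ## §2 POSITIVITY ⟹ BV-STABILITY: the solution is controlled by the tail variation of the input -/

/-- **UPPER BV BOUND.**  If every indicator solution lies in `[0,1]` (the END at every truncation), then for every zero-tailed input
`S f n ≤ Σ_{n ≤ J ≤ N} max (f J − f (J+1)) 0` — the POSITIVE variation of `f` below `n`. [folklore] -/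
theorem sol_le_posVar (hR : ∀ v n, R v n = ∑ l ∈ range N, K n l * v (n + 1 + l))
    (hS : ∀ w : ℕ → ℝ, (∀ n, N < n → w n = 0) → (∀ n, N < n → S w n = 0) ∧ ∀ n, S w n = w n - R (S w) n)
    (hEND : ∀ J n, J ≤ N → 0 ≤ S (fun m => if m ≤ J then (1 : ℝ) else 0) n ∧ S (fun m => if m ≤ J then (1 : ℝ) else 0) n ≤ 1)
    {f : ℕ → ℝ} (hf : ∀ n, N < n → f n = 0) (n : ℕ) :
    S f n ≤ ∑ J ∈ Ico n (N + 1), max (f J - f (J + 1)) 0 := by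
  by_cases hn : n ≤ N + 1
  · rw [sol_eq_sum_Ico hR hS hf hn]
    refine sum_le_sum fun J hJ => ?_
    have hJN : J ≤ N := by have := (mem_Ico.mp hJ).2; omega
    obtain ⟨h0, h1⟩ := hEND J n hJN
    by_cases hd : 0 ≤ f J - f (J + 1)
    · rw [max_eq_left hd]; nlinarith
    · rw [max_eq_right (le_of_lt (not_le.mp hd))]; nlinarith
  · rw [(hS f hf).1 n (by omega)]
    exact sum_nonneg fun J _ => le_max_right _ _

/-- **LOWER BV BOUND WITH A FLOOR.**  If the indicator solutions lie in `[0,1]` and are at least `u` at the depth `n` for every truncation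
`J ≥ n`, then `S f n ≥ u·Σ_{n≤J≤N} max (f J − f (J+1)) 0 + Σ_{n≤J≤N} min (f J − f (J+1)) 0`. [folklore] -/
theorem sol_ge_var (hR : ∀ v n, R v n = ∑ l ∈ range N, K n l * v (n + 1 + l))
    (hS : ∀ w : ℕ → ℝ, (∀ n, N < n → w n = 0) → (∀ n, N < n → S w n = 0) ∧ ∀ n, S w n = w n - R (S w) n)
    (hEND : ∀ J n, J ≤ N → 0 ≤ S (fun m => if m ≤ J then (1 : ℝ) else 0) n ∧ S (fun m => if m ≤ J then (1 : ℝ) else 0) n ≤ 1)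
    {f : ℕ → ℝ} (hf : ∀ n, N < n → f n = 0) {n : ℕ} {u : ℝ}
    (hu : ∀ J, n ≤ J → J ≤ N → u ≤ S (fun m => if m ≤ J then (1 : ℝ) else 0) n) :
    u * ∑ J ∈ Ico n (N + 1), max (f J - f (J + 1)) 0 + ∑ J ∈ Ico n (N + 1), min (f J - f (J + 1)) 0 ≤ S f n := by
  by_cases hn : n ≤ N + 1
  · rw [sol_eq_sum_Ico hR hS hf hn, mul_sum, ← sum_add_distrib]
    refine sum_le_sum fun J hJ => ?_
    have hJ' := mem_Ico.mp hJ
    have hJN : J ≤ N := by omega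
    obtain ⟨h0, h1⟩ := hEND J n hJN
    have huJ := hu J hJ'.1 hJN
    by_cases hd : 0 ≤ f J - f (J + 1)
    · rw [max_eq_left hd, min_eq_right hd, add_zero]; nlinarith
    · have hd' := le_of_lt (not_le.mp hd)
      rw [max_eq_right hd', min_eq_left hd', mul_zero, zero_add]; nlinarith
  · have he : Ico n (N + 1) = ∅ := Ico_eq_empty (by omega)
    rw [he, sum_empty, sum_empty, mul_zero, add_zero, (hS f hf).1 n (by omega)]

/-- **ABSOLUTE BV BOUND.**  Under the END at every truncation, `|S f n| ≤ Σ_{n≤J≤N} |f J − f (J+1)|`: positivity on monotone inputs is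
stability in total variation on arbitrary inputs. [folklore] -/
theorem abs_sol_le_var (hR : ∀ v n, R v n = ∑ l ∈ range N, K n l * v (n + 1 + l))
    (hS : ∀ w : ℕ → ℝ, (∀ n, N < n → w n = 0) → (∀ n, N < n → S w n = 0) ∧ ∀ n, S w n = w n - R (S w) n)
    (hEND : ∀ J n, J ≤ N → 0 ≤ S (fun m => if m ≤ J then (1 : ℝ) else 0) n ∧ S (fun m => if m ≤ J then (1 : ℝ) else 0) n ≤ 1)
    {f : ℕ → ℝ} (hf : ∀ n, N < n → f n = 0) (n : ℕ) :
    |S f n| ≤ ∑ J ∈ Ico n (N + 1), |f J - f (J + 1)| := by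
  rw [abs_le]
  constructor
  · have h := sol_ge_var hR hS hEND hf (n := n) (u := 0) (fun J _ hJN => (hEND J n hJN).1)
    rw [zero_mul, zero_add] at h
    refine le_trans ?_ h
    rw [← sum_neg_distrib]
    exact sum_le_sum fun J _ => le_min (neg_abs_le _) (neg_nonpos.mpr (abs_nonneg _))
  · exact (sol_le_posVar hR hS hEND hf n).trans (sum_le_sum fun J _ => max_le (le_abs_self _) (abs_nonneg _))

/-- Telescoping over the truncations below `n`: `Σ_{n≤J≤N} (f J − f (J+1)) = f n` for `f` vanishing beyond `N` (`n ≤ N+1`). [folklore] -/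
theorem sum_Ico_steps {f : ℕ → ℝ} (hf : ∀ n, N < n → f n = 0) {n : ℕ} (hn : n ≤ N + 1) :
    ∑ J ∈ Ico n (N + 1), (f J - f (J + 1)) = f n := by
  have h1 : ∑ J ∈ range n, (f J - f (J + 1)) * (if n ≤ J then (1 : ℝ) else 0) = 0 :=
    sum_eq_zero fun J hJ => by rw [if_neg (by have := mem_range.mp hJ; omega), mul_zero]
  have h2 : ∑ J ∈ Ico n (N + 1), (f J - f (J + 1)) * (if n ≤ J then (1 : ℝ) else 0) = ∑ J ∈ Ico n (N + 1), (f J - f (J + 1)) :=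
    sum_congr rfl fun J hJ => by rw [if_pos (mem_Ico.mp hJ).1, mul_one]
  rw [← h2, ← sum_steps_eq hf n, ← sum_range_add_sum_Ico _ hn, h1, zero_add]

/-- **ROBUST END (global form).**  For a zero-tailed input `f`, under the END at every truncation with floor `u` at the depth `n`:
`S f n ≥ u·f n − (1 − u)·Inc_n f`, where `Inc_n f = Σ_{n≤J≤N} max (f (J+1) − f J) 0` is the total INCREASE of `f` below `n` — a non-increasing
excess gives back `u·f n`, and every unit of upward variation costs at most `1 − u`. [folklore] -/
theorem sol_ge_floor_sub_increase (hR : ∀ v n, R v n = ∑ l ∈ range N, K n l * v (n + 1 + l))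
    (hS : ∀ w : ℕ → ℝ, (∀ n, N < n → w n = 0) → (∀ n, N < n → S w n = 0) ∧ ∀ n, S w n = w n - R (S w) n)
    (hEND : ∀ J n, J ≤ N → 0 ≤ S (fun m => if m ≤ J then (1 : ℝ) else 0) n ∧ S (fun m => if m ≤ J then (1 : ℝ) else 0) n ≤ 1)
    {f : ℕ → ℝ} (hf : ∀ n, N < n → f n = 0) {n : ℕ} {u : ℝ}
    (hu : ∀ J, n ≤ J → J ≤ N → u ≤ S (fun m => if m ≤ J then (1 : ℝ) else 0) n) :
    u * f n - (1 - u) * ∑ J ∈ Ico n (N + 1), max (f (J + 1) - f J) 0 ≤ S f n := by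
  by_cases hn : n ≤ N + 1
  · have h := sol_ge_var hR hS hEND hf hu
    have hmax : ∀ J, max (f J - f (J + 1)) 0 = (f J - f (J + 1)) + max (f (J + 1) - f J) 0 := fun J => by
      by_cases hd : 0 ≤ f J - f (J + 1)
      · rw [max_eq_left hd, max_eq_right (by linarith), add_zero]
      · rw [max_eq_right (le_of_lt (not_le.mp hd)), max_eq_left (by linarith)]; ring
    have hmin : ∀ J, min (f J - f (J + 1)) 0 = -max (f (J + 1) - f J) 0 := fun J => by
      by_cases hd : 0 ≤ f J - f (J + 1)
      · rw [min_eq_right hd, max_eq_right (by linarith), neg_zero]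
      · rw [min_eq_left (le_of_lt (not_le.mp hd)), max_eq_left (by linarith)]; ring
    simp_rw [hmax, hmin, sum_add_distrib, sum_neg_distrib, sum_Ico_steps hf hn] at h
    linarith
  · have he : Ico n (N + 1) = ∅ := Ico_eq_empty (by omega)
    rw [he, sum_empty, mul_zero, sub_zero, (hS f hf).1 n (by omega), hf n (by omega), mul_zero]

/-! ## §3 LOCALITY: a light kernel of finite range forgets distant inputs geometrically -/

/-- **NO AMPLIFICATION ACROSS A GAP.**  Non-negative kernel with row sums `≤ 1`; the input `w` vanishes on `[a, b)`; the solution is bounded by `M` in absolute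
value from the depth `b` on.  Then it is bounded by `M` from the depth `a` on. [folklore] -/
theorem abs_sol_le_of_gap (hR : ∀ v n, R v n = ∑ l ∈ range N, K n l * v (n + 1 + l)) (hK : ∀ n l, 0 ≤ K n l)
    (hrow : ∀ n, ∑ l ∈ range N, K n l ≤ 1) {w t : ℕ → ℝ} {a b : ℕ} (hw : ∀ m, a ≤ m → m < b → w m = 0)
    (hrec : ∀ n, t n = w n - R t n) {M : ℝ} (hM : ∀ m, b ≤ m → |t m| ≤ M) : ∀ m, a ≤ m → |t m| ≤ M := by
  have hM0 : 0 ≤ M := (abs_nonneg _).trans (hM b le_rfl)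
  suffices h : ∀ d m, b ≤ m + d → a ≤ m → |t m| ≤ M from fun m hm => h b m (by omega) hm
  intro d
  induction d with
  | zero => intro m hb _; exact hM m (by omega)
  | succ d ih =>
    intro m hb ha
    by_cases hbm : b ≤ m
    · exact hM m hbm
    rw [hrec m, hw m ha (by omega), zero_sub, abs_neg, hR]
    calc |∑ l ∈ range N, K m l * t (m + 1 + l)| ≤ ∑ l ∈ range N, |K m l * t (m + 1 + l)| := abs_sum_le_sum_abs _ _
      _ = ∑ l ∈ range N, K m l * |t (m + 1 + l)| := sum_congr rfl fun l _ => by rw [abs_mul, abs_of_nonneg (hK m l)]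
      _ ≤ ∑ l ∈ range N, K m l * M :=
          sum_le_sum fun l _ => mul_le_mul_of_nonneg_left (ih (m + 1 + l) (by omega) (by omega)) (hK m l)
      _ = (∑ l ∈ range N, K m l) * M := by rw [sum_mul]
      _ ≤ 1 * M := mul_le_mul_of_nonneg_right (hrow m) hM0
      _ = M := one_mul M

/-- **LOCALITY.**  Non-negative kernel with row sums `≤ ρ ≤ 1` reading only the lags `< k` (`k ≥ 1`); the input vanishes on `[a, b)` and the solution is
bounded by `M` from `b` on.  Then `|t m| ≤ ρ^D·M` whenever `a ≤ m` and `m + D·k ≤ b`: every young window crossed without input costs a factor `ρ`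
— the influence of the input beyond `b` on the depth `m` decays GEOMETRICALLY in the number of windows between them. [folklore] -/
theorem abs_sol_le_pow_of_gap (hR : ∀ v n, R v n = ∑ l ∈ range N, K n l * v (n + 1 + l)) (hK : ∀ n l, 0 ≤ K n l)
    {ρ : ℝ} (hrow : ∀ n, ∑ l ∈ range N, K n l ≤ ρ) (hρ1 : ρ ≤ 1) {k : ℕ} (hk : 1 ≤ k) (hKk : ∀ n l, k ≤ l → K n l = 0)
    {w t : ℕ → ℝ} {a b : ℕ} (hw : ∀ m, a ≤ m → m < b → w m = 0) (hrec : ∀ n, t n = w n - R t n)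
    {M : ℝ} (hM : ∀ m, b ≤ m → |t m| ≤ M) : ∀ D m, a ≤ m → m + D * k ≤ b → |t m| ≤ ρ ^ D * M := by
  have hρ0 : 0 ≤ ρ := (sum_nonneg fun l _ => hK 0 l).trans (hrow 0)
  have hM0 : 0 ≤ M := (abs_nonneg _).trans (hM b le_rfl)
  have h0 := abs_sol_le_of_gap hR hK (fun n => (hrow n).trans hρ1) hw hrec hM
  intro D
  induction D with
  | zero => intro m ha _; rw [pow_zero, one_mul]; exact h0 m ha
  | succ D ih =>
    intro m ha hb
    have hsm : (D + 1) * k = D * k + k := Nat.succ_mul D k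
    have hmb : m < b := by omega
    rw [hrec m, hw m ha hmb, zero_sub, abs_neg, hR]
    calc |∑ l ∈ range N, K m l * t (m + 1 + l)| ≤ ∑ l ∈ range N, |K m l * t (m + 1 + l)| := abs_sum_le_sum_abs _ _
      _ = ∑ l ∈ range N, K m l * |t (m + 1 + l)| := sum_congr rfl fun l _ => by rw [abs_mul, abs_of_nonneg (hK m l)]
      _ ≤ ∑ l ∈ range N, K m l * (ρ ^ D * M) := sum_le_sum fun l _ => by
          by_cases hl : k ≤ l
          · rw [hKk m l hl, zero_mul, zero_mul]
          · exact mul_le_mul_of_nonneg_left (ih (m + 1 + l) (by omega) (by omega)) (hK m l)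
      _ = (∑ l ∈ range N, K m l) * (ρ ^ D * M) := by rw [sum_mul]
      _ ≤ ρ * (ρ ^ D * M) := mul_le_mul_of_nonneg_right (hrow m) (by positivity)
      _ = ρ ^ (D + 1) * M := by rw [pow_succ]; ring

/-! ## §4 A floor for light rows: `S e ≥ (1 − ρ)·e` -/

/-- **THE LIGHT FLOOR.**  Non-negative kernel with row sums `≤ ρ_n ≤ 1`; non-negative non-increasing zero-tailed input `w`.  Then the solution satisfies
`(1 − ρ_n)·w n ≤ t n` (and `t ≤ w` by (E71a)): a lone age of damped load `x̃ ≤ √2∕2` leaves at least `1 − x̃` of every admissible excess. [folklore] -/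
theorem sol_ge_one_sub_row (hR : ∀ v n, R v n = ∑ l ∈ range N, K n l * v (n + 1 + l)) (hK : ∀ n l, 0 ≤ K n l)
    {ρ : ℕ → ℝ} (hrow : ∀ n, ∑ l ∈ range N, K n l ≤ ρ n) (hρ1 : ∀ n, ρ n ≤ 1)
    {w t : ℕ → ℝ} (hw0 : ∀ n, 0 ≤ w n) (hanti : ∀ n, w (n + 1) ≤ w n)
    (htail : ∀ n, N < n → t n = 0) (hrec : ∀ n, t n = w n - R t n) (n : ℕ) : (1 - ρ n) * w n ≤ t n := by
  have h := sol_nonneg_le_of_antitone hR hK (fun n => (hrow n).trans (hρ1 n)) hw0 hanti htail hrec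
  have hmono : ∀ m j, w (m + j) ≤ w m := fun m j => by
    induction j with
    | zero => simp
    | succ j ih => exact (by rw [← add_assoc]; exact hanti _ : w (m + (j + 1)) ≤ w (m + j)).trans ih
  have h1 : R t n ≤ R w n := read_le_read hR hK fun m _ => (h m).2
  have h2 : R w n ≤ ρ n * w n := by
    rw [hR]
    calc ∑ l ∈ range N, K n l * w (n + 1 + l) ≤ ∑ l ∈ range N, K n l * w n :=
          sum_le_sum fun l _ => mul_le_mul_of_nonneg_left (by rw [add_assoc]; exact hmono n (1 + l)) (hK n l)
      _ = (∑ l ∈ range N, K n l) * w n := by rw [sum_mul]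
      _ ≤ ρ n * w n := mul_le_mul_of_nonneg_right (hrow n) (hw0 n)
  rw [hrec n]; linarith

/-! ## §5 THE ROBUST LOCAL END: floor × excess, minus the local increase, minus a geometrically small far field -/

/-- Reads are additive. [folklore] -/
theorem read_add' (hR : ∀ v n, R v n = ∑ l ∈ range N, K n l * v (n + 1 + l)) (u v : ℕ → ℝ) (n : ℕ) :
    R (fun m => u m + v m) n = R u n + R v n := by
  rw [hR, hR, hR, ← sum_add_distrib]
  exact sum_congr rfl fun l _ => by ring

/-- Solutions are additive in the input. [folklore] -/
theorem sol_add (hR : ∀ v n, R v n = ∑ l ∈ range N, K n l * v (n + 1 + l))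
    (hS : ∀ w : ℕ → ℝ, (∀ n, N < n → w n = 0) → (∀ n, N < n → S w n = 0) ∧ ∀ n, S w n = w n - R (S w) n)
    {f g : ℕ → ℝ} (hf : ∀ n, N < n → f n = 0) (hg : ∀ n, N < n → g n = 0) :
    ∀ n, S (fun m => f m + g m) n = S f n + S g n := by
  have hfg : ∀ n, N < n → (fun m => f m + g m) n = 0 := fun n hn => by simp only [hf n hn, hg n hn, add_zero]
  refine sol_unique hR (hS _ hfg).1 (hS _ hfg).2 (fun n hn => by simp only [(hS f hf).1 n hn, (hS g hg).1 n hn, add_zero])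
    fun n => ?_
  simp only [read_add' hR]
  linarith [(hS f hf).2 n, (hS g hg).2 n]

/-- **THE ROBUST LOCAL END.**  A non-negative kernel with row sums `≤ ρ ≤ 1` reading only the lags `< k` (`k ≥ 1`) — a YOUNG system — whose indicator
solutions lie in `[0,1]` (its END at every truncation) and are at least `u ∈ [0,1]` at the depth `n` for the truncations `J ≥ n` (its FLOOR, e.g. `1 − x̃` by
§4); a non-negative zero-tailed input `f`; a number `D` of young windows, `b = n + D·k`.  Then
`S f n ≥ u·f n − (1 − u)·Σ_{n ≤ J < b} max (f (J+1) − f J) 0 − ρ^D·(f b + Σ_{b ≤ J ≤ N} |f J − f (J+1)|)`: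
the young surplus at `n` is at least the floor times the excess AT `n`, minus the INCREASE of the excess over the next `D` young windows, minus a far
field damped by `ρ^D`.  The KEY hypothesis of (E71a) (the excess is a young supersolution) is replaced by «the excess hardly increases over a few young
windows» — with an explicit price. [folklore] -/
theorem sol_ge_local (hR : ∀ v n, R v n = ∑ l ∈ range N, K n l * v (n + 1 + l))
    (hS : ∀ w : ℕ → ℝ, (∀ n, N < n → w n = 0) → (∀ n, N < n → S w n = 0) ∧ ∀ n, S w n = w n - R (S w) n)
    (hK : ∀ n l, 0 ≤ K n l) {ρ : ℝ} (hrow : ∀ n, ∑ l ∈ range N, K n l ≤ ρ) (hρ1 : ρ ≤ 1) {k : ℕ} (hk : 1 ≤ k)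
    (hKk : ∀ n l, k ≤ l → K n l = 0)
    (hEND : ∀ J n, J ≤ N → 0 ≤ S (fun m => if m ≤ J then (1 : ℝ) else 0) n ∧ S (fun m => if m ≤ J then (1 : ℝ) else 0) n ≤ 1)
    {f : ℕ → ℝ} (hf : ∀ n, N < n → f n = 0) (hf0 : ∀ n, 0 ≤ f n) {n D : ℕ} {u : ℝ} (hu0 : 0 ≤ u) (hu1 : u ≤ 1)
    (hu : ∀ J, n ≤ J → J ≤ N → u ≤ S (fun m => if m ≤ J then (1 : ℝ) else 0) n) :
    u * f n - (1 - u) * ∑ J ∈ Ico n (n + D * k), max (f (J + 1) - f J) 0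
      - ρ ^ D * (f (n + D * k) + ∑ J ∈ Ico (n + D * k) (N + 1), |f J - f (J + 1)|) ≤ S f n := by
  have hVar0 : ∀ a, 0 ≤ ∑ J ∈ Ico a (N + 1), |f J - f (J + 1)| := fun a => sum_nonneg fun _ _ => abs_nonneg _
  have h1u : 0 ≤ 1 - u := by linarith
  by_cases hD : D = 0
  · subst hD
    simp only [zero_mul, add_zero, Ico_self, sum_empty, mul_zero, sub_zero, pow_zero, one_mul]
    have h := sol_ge_floor_sub_increase hR hS hEND hf (n := n) (u := u) hu
    have hInc0 : 0 ≤ ∑ J ∈ Ico n (N + 1), max (f (J + 1) - f J) 0 := sum_nonneg fun _ _ => le_max_right _ _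
    have hInc : ∑ J ∈ Ico n (N + 1), max (f (J + 1) - f J) 0 ≤ ∑ J ∈ Ico n (N + 1), |f J - f (J + 1)| :=
      sum_le_sum fun J _ => max_le (by rw [abs_sub_comm]; exact le_abs_self _) (abs_nonneg _)
    have hprod : (1 - u) * ∑ J ∈ Ico n (N + 1), max (f (J + 1) - f J) 0 ≤ 1 * ∑ J ∈ Ico n (N + 1), max (f (J + 1) - f J) 0 :=
      mul_le_mul_of_nonneg_right (by linarith) hInc0
    linarith [hf0 n]
  · set b := n + D * k with hb
    have hDk : 0 < D * k := Nat.mul_pos (Nat.pos_of_ne_zero hD) (by omega)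
    have hnb : n < b := by omega
    -- the near and the far part of the excess
    set f₁ : ℕ → ℝ := fun m => if m < b then f m else 0 with hf₁
    set f₂ : ℕ → ℝ := fun m => if m < b then 0 else f m with hf₂
    have hf₁t : ∀ m, N < m → f₁ m = 0 := fun m hm => by simp only [hf₁, hf m hm, ite_self]
    have hf₂t : ∀ m, N < m → f₂ m = 0 := fun m hm => by simp only [hf₂, hf m hm, ite_self]
    have hsplit : S f n = S f₁ n + S f₂ n := by
      rw [← sol_add hR hS hf₁t hf₂t]
      exact congrArg (fun g => S g n) (funext fun m => by simp only [hf₁, hf₂]; split_ifs <;> simp)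
    -- near part: floor minus local increase
    have hnear := sol_ge_floor_sub_increase hR hS hEND hf₁t (n := n) (u := u) hu
    have hf₁n : f₁ n = f n := by simp only [hf₁, if_pos hnb]
    have hpt : ∀ J, max (f₁ (J + 1) - f₁ J) 0 ≤ if J < b then max (f (J + 1) - f J) 0 else 0 := fun J => by
      by_cases hJ1 : J + 1 < b
      · simp only [hf₁, if_pos hJ1, if_pos (show J < b by omega)]; exact le_rfl
      · by_cases hJ : J < b
        · simp only [hf₁, if_neg hJ1, if_pos hJ, zero_sub]
          exact max_le ((neg_nonpos.mpr (hf0 J)).trans (le_max_right _ _)) (le_max_right _ _)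
        · simp only [hf₁, if_neg hJ1, if_neg hJ, sub_self, max_self]; exact le_rfl
    have hInc : ∑ J ∈ Ico n (N + 1), max (f₁ (J + 1) - f₁ J) 0 ≤ ∑ J ∈ Ico n b, max (f (J + 1) - f J) 0 :=
      calc ∑ J ∈ Ico n (N + 1), max (f₁ (J + 1) - f₁ J) 0
          ≤ ∑ J ∈ Ico n (N + 1), (if J < b then max (f (J + 1) - f J) 0 else 0) := sum_le_sum fun J _ => hpt J
        _ = ∑ J ∈ (Ico n (N + 1)).filter (· < b), max (f (J + 1) - f J) 0 := (sum_filter _ _).symm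
        _ ≤ ∑ J ∈ Ico n b, max (f (J + 1) - f J) 0 :=
            sum_le_sum_of_subset_of_nonneg (fun J hJ => by
              rw [mem_filter, mem_Ico] at hJ; rw [mem_Ico]; exact ⟨hJ.1.1, hJ.2⟩) (fun _ _ _ => le_max_right _ _)
    -- far part: BV bound beyond `b`, then locality across `D` young windows
    have hM : ∀ m, b ≤ m → |S f₂ m| ≤ f b + ∑ J ∈ Ico b (N + 1), |f J - f (J + 1)| := fun m hm => by
      refine (abs_sol_le_var hR hS hEND hf₂t m).trans ?_
      have heq : ∀ J ∈ Ico m (N + 1), |f₂ J - f₂ (J + 1)| = |f J - f (J + 1)| := fun J hJ => by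
        have := (mem_Ico.mp hJ).1
        simp only [hf₂, if_neg (show ¬ J < b by omega), if_neg (show ¬ J + 1 < b by omega)]
      rw [sum_congr rfl heq]
      have hsub : ∑ J ∈ Ico m (N + 1), |f J - f (J + 1)| ≤ ∑ J ∈ Ico b (N + 1), |f J - f (J + 1)| :=
        sum_le_sum_of_subset_of_nonneg (Ico_subset_Ico hm le_rfl) fun _ _ _ => abs_nonneg _
      linarith [hf0 b]
    have hw2 : ∀ m, 0 ≤ m → m < b → f₂ m = 0 := fun m _ hm => by simp only [hf₂, if_pos hm]
    have hfar := abs_sol_le_pow_of_gap hR hK hrow hρ1 hk hKk hw2 (hS f₂ hf₂t).2 hM D n (Nat.zero_le n) le_rfl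
    have hfar' := (abs_le.mp hfar).1
    rw [hsplit]
    rw [hf₁n] at hnear
    have hprod := mul_le_mul_of_nonneg_left hInc h1u
    linarith

end Summit.QuantumFields.BalabanUV.Beta.EriceRemainderEnclosureHistoryAutonomyComparisonAgeCompositionBVStability

end
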